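import Summits.BirchSwinnertonDyer.BirchSwinnertonDyer.Theorems.Rank2ObservatoryRank2CompleteBelow25000
import Summits.BirchSwinnertonDyer.BirchSwinnertonDyer.Theorems.Rank2ObservatoryRank2Rows05Complete
import Summits.BirchSwinnertonDyer.BirchSwinnertonDyer.Theorems.Rank2ObservatoryRank2Rows06aComplete
import Summits.BirchSwinnertonDyer.BirchSwinnertonDyer.Theorems.Rank2ObservatoryRank2Rows06bComplete
import Summits.BirchSwinnertonDyer.BirchSwinnertonDyer.Theorems.Rank2ObservatoryRank2Rows07aComplete
import Summits.BirchSwinnertonDyer.BirchSwinnertonDyer.Theorems.Rank2ObservatoryRank2Rows07bComplete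
import Summits.BirchSwinnertonDyer.BirchSwinnertonDyer.Theorems.Rank2ObservatoryRank2Rows08aComplete
import Summits.BirchSwinnertonDyer.BirchSwinnertonDyer.Theorems.Rank2ObservatoryRank2Rows08bComplete
import HarnessLib

/-!
# BirchSwinnertonDyer — rank ≥ 2 observatory: every rank-2 census curve of conductor < 45000 is certified

HONEST FRAMING: per-curve certified theorems and census instruments; no claim on BSD in rank ≥ 2.

EVERY rank-2 census curve of conductor `N < 45000` — every row `r ∈ rank2Table` (Cremona's table of
the `348672` curves of rank `2` and conductor `< 500000`) with `r.N < 45000` — has an UNCONDITIONAL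
kernel certificate `2 ≤ rank_ℤ E_r(ℚ)`. Reason: a row with `N < 45000` lies in one of the `12`
chunks `rank2Rows00 … rank2Rows08b` (every other chunk / decade has a certified conductor range
starting at `45000` or above), and each of those chunks is COMPLETE
(`Rank2ObservatoryRank2Rows<c>Complete`: merge certificates over the aggregated kernel-certificate
indices). Consequences for all these curves: `L(E,1) = L′(E,1) = 0` exactly given only the named
literature fact `hGZK`, and `r_an = rank = 2` given `hGZK`, `hup`, `hL2`. This extends
`Rank2ObservatoryRank2CompleteBelow25000` (conductor-ascending certification, chunk by chunk);
nothing is claimed for conductor `N ≥ 45000`.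

References: [cite: CremonaAlgorithms1997, Table 1, §2.13, §3.5] (the census, `L^{(r)}(E,1)`, conductor ranges);
[cite: Darmon2004, Thm. 3.22] (Gross–Zagier–Kolyvagin); [cite: SilvermanAEC2009, Thm. VIII.6.7] (reduction injective on
prime-to-`p` torsion — the engine of the per-curve kernel certificates).
-/

namespace Summit.BirchSwinnertonDyer.BirchSwinnertonDyer.Rank2Observatory

open WeierstrassCurve Literature Literature.NumberTheory.EllipticCurves

/-- **A census row of conductor `N < 45000` lies in one of the chunks `rank2Rows00 … rank2Rows08b`**
(all other chunks and decades have certified conductor ranges `≥ 45000`). [cite: CremonaAlgorithms1997, Table 1] -/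
theorem mem_chunks_of_mem_rank2Table_of_conductor_lt_45000 {r : Rank2Row} (hr : r ∈ rank2Table)
    (hN : r.N < 45000) :
    r ∈ rank2Rows00 ∨ r ∈ rank2Rows01 ∨ r ∈ rank2Rows02 ∨ r ∈ rank2Rows03 ∨ r ∈ rank2Rows04 ∨ r ∈
    rank2Rows05 ∨ r ∈ rank2Rows06a ∨ r ∈ rank2Rows06b ∨ r ∈ rank2Rows07a ∨ r ∈ rank2Rows07b ∨ r ∈
    rank2Rows08a ∨ r ∈ rank2Rows08b := by
  simp only [rank2Table, rank2Decades, List.flatten_cons, List.flatten_nil, List.mem_append,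
    List.not_mem_nil, or_false] at hr
  rcases hr with h | h | h | h | h | h | h | h | h | h
  · simp only [rank2Decade0, rank2Decade0Chunks, List.flatten_cons, List.flatten_nil, List.mem_append,
    List.not_mem_nil, or_false] at h
    rcases h with h | h | h | h | h | h | h | h | h | h | h | h | h | h
    exacts [
      Or.inl h,
      Or.inr (Or.inl h),
      Or.inr (Or.inr (Or.inl h)),
      Or.inr (Or.inr (Or.inr (Or.inl h))),
      Or.inr (Or.inr (Or.inr (Or.inr (Or.inl h)))),
      Or.inr (Or.inr (Or.inr (Or.inr (Or.inr (Or.inl h))))),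
      Or.inr (Or.inr (Or.inr (Or.inr (Or.inr (Or.inr (Or.inl h)))))),
      Or.inr (Or.inr (Or.inr (Or.inr (Or.inr (Or.inr (Or.inr (Or.inl h))))))),
      Or.inr (Or.inr (Or.inr (Or.inr (Or.inr (Or.inr (Or.inr (Or.inr (Or.inl h)))))))),
      Or.inr (Or.inr (Or.inr (Or.inr (Or.inr (Or.inr (Or.inr (Or.inr (Or.inr (Or.inl h))))))))),
      Or.inr (Or.inr (Or.inr (Or.inr (Or.inr (Or.inr (Or.inr (Or.inr (Or.inr (Or.inr (Or.inl h)))))))))),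
      Or.inr (Or.inr (Or.inr (Or.inr (Or.inr (Or.inr (Or.inr (Or.inr (Or.inr (Or.inr (Or.inr h)))))))))),
      absurd hN (not_lt.mpr (le_conductor_of_all_range rank2Rows09a_conductor h)),
      absurd hN (not_lt.mpr (le_trans (by norm_num) (le_conductor_of_all_range rank2Rows09b_conductor h)))]
  · exact absurd hN (not_lt.mpr (le_trans (by norm_num) (le_conductor_of_mem_rank2Decade1 h)))
  · exact absurd hN (not_lt.mpr (le_trans (by norm_num) (le_conductor_of_mem_rank2Decade2 h)))
  · exact absurd hN (not_lt.mpr (le_trans (by norm_num) (le_conductor_of_mem_rank2Decade3 h)))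
  · exact absurd hN (not_lt.mpr (le_trans (by norm_num) (le_conductor_of_mem_rank2Decade4 h)))
  · exact absurd hN (not_lt.mpr (le_trans (by norm_num) (le_conductor_of_mem_rank2Decade5 h)))
  · exact absurd hN (not_lt.mpr (le_trans (by norm_num) (le_conductor_of_mem_rank2Decade6 h)))
  · exact absurd hN (not_lt.mpr (le_trans (by norm_num) (le_conductor_of_mem_rank2Decade7 h)))
  · exact absurd hN (not_lt.mpr (le_trans (by norm_num) (le_conductor_of_mem_rank2Decade8 h)))
  · exact absurd hN (not_lt.mpr (le_trans (by norm_num) (le_conductor_of_mem_rank2Decade9 h)))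

/-- **Every rank-2 census curve of conductor `N < 45000` has `2 ≤ rank_ℤ E(ℚ)`** — with NO hypothesis
(kernel certificates for every curve, chunk completeness by merge certificates).
[cite: CremonaAlgorithms1997, Table 1, §3.5] [cite: SilvermanAEC2009, Thm. VIII.6.7] -/
theorem two_le_mordellWeilRank_of_mem_rank2Table_of_conductor_lt_45000 {r : Rank2Row} (hr : r ∈ rank2Table)
    (hN : r.N < 45000) : 2 ≤ r.curve.mordellWeilRank := by
  rcases mem_chunks_of_mem_rank2Table_of_conductor_lt_45000 hr hN with h | h | h | h | h | h | h | h | h | h | h | h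
  exacts [two_le_mordellWeilRank_of_mem_rank2Rows00 h,
    two_le_mordellWeilRank_of_mem_rank2Rows01 h, two_le_mordellWeilRank_of_mem_rank2Rows02 h,
    two_le_mordellWeilRank_of_mem_rank2Rows03 h, two_le_mordellWeilRank_of_mem_rank2Rows04 h,
    two_le_mordellWeilRank_of_mem_rank2Rows05 h, two_le_mordellWeilRank_of_mem_rank2Rows06a h,
    two_le_mordellWeilRank_of_mem_rank2Rows06b h, two_le_mordellWeilRank_of_mem_rank2Rows07a h,
    two_le_mordellWeilRank_of_mem_rank2Rows07b h, two_le_mordellWeilRank_of_mem_rank2Rows08a h,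
    two_le_mordellWeilRank_of_mem_rank2Rows08b h]

/-- **Exact vanishing `L(E,1) = L′(E,1) = 0` for every rank-2 census curve of conductor `N < 45000`**,
given ONLY the named literature fact `hGZK` (Gross–Zagier–Kolyvagin: `r_an ≤ 1 → rank = r_an`).
[cite: Darmon2004, Thm. 3.22] [cite: CremonaAlgorithms1997, §2.13] -/
theorem lvalue_lderiv_eq_zero_of_mem_rank2Table_of_conductor_lt_45000 {r : Rank2Row} (hr : r ∈ rank2Table)
    (hN : r.N < 45000) (hGZK : rank_eq_analyticRank_of_analyticRank_le_one) :
    r.curve.entireLFunction 1 = 0 ∧ deriv r.curve.entireLFunction 1 = 0 :=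
  ⟨rank2_lvalue_eq_zero_of_mem hr hGZK
      (two_le_mordellWeilRank_of_mem_rank2Table_of_conductor_lt_45000 hr hN),
    rank2_lderiv_eq_zero_of_mem hr hGZK
      (two_le_mordellWeilRank_of_mem_rank2Table_of_conductor_lt_45000 hr hN)⟩

/-- **`r_an(E) = rank_ℤ E(ℚ) = 2` for every rank-2 census curve of conductor `N < 45000`** with the
certificate field `rank_lower` DISCHARGED; remaining named hypotheses `hGZK` (literature), `hup`
(2-descent upper bound), `hL2` (`L″(E,1) ≠ 0`). [cite: CremonaAlgorithms1997, §2.13]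
[cite: Darmon2004, Thm. 3.22] -/
theorem analyticRank_eq_rank_of_mem_rank2Table_of_conductor_lt_45000 {r : Rank2Row} (hr : r ∈ rank2Table)
    (hN : r.N < 45000) (hGZK : rank_eq_analyticRank_of_analyticRank_le_one)
    (hup : r.curve.mordellWeilRank ≤ 2) (hL2 : iteratedDeriv 2 r.curve.entireLFunction 1 ≠ 0) :
    r.curve.analyticRank = r.curve.mordellWeilRank ∧ r.curve.analyticRank = 2 :=
  ⟨rank2_analyticRank_eq_rank_of_mem hr hGZK
      (two_le_mordellWeilRank_of_mem_rank2Table_of_conductor_lt_45000 hr hN) hup hL2,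
    rank2_analyticRank_eq_two_of_mem hr hGZK
      (two_le_mordellWeilRank_of_mem_rank2Table_of_conductor_lt_45000 hr hN) hup hL2⟩

end Summit.BirchSwinnertonDyer.BirchSwinnertonDyer.Rank2Observatory
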